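import Summits.RiemannHypothesis.RiemannHypothesis.Theorems.PfPersistenceGalerkinFormDomain
import Summits.RiemannHypothesis.RiemannHypothesis.Theorems.PfPersistenceM2Thermometer
import Summits.RiemannHypothesis.RiemannHypothesis.Theorems.SoloInformedWeilSurface
import HarnessLib

/-!
# GAL-1 typed: Galerkin FLOORS transfer to the continuum even ground energy (pub-rhpf, barrier-typer gen 3)

**HONEST FRAMING. This is a long-odds MECHANISM SEARCH; no RH claims.** Everything here is RH-free bookkeeping
between the cell's Galerkin records and the continuum model; the named `Prop`s are STATEMENTS (targets), the
reductions between them are PROVED. The last corollary is the G1.05 / G1.14 rows' THERMOMETER REDUCTION (label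
RH-strength, E1): it derives RH from hypotheses nobody has, and asserts nothing about them.

`PfPersistenceGalerkinFormDomain` (barrier-prover gen 2) typed GAL-0 = the Rayleigh–Ritz direction
`ε_ev(a) ≤ ε₁^{(N)}(a)` from (i) `GalerkinMatrixIdentity` (window-matrix identity, cand-3) and (ii)
`CutoffProfileFormDensity` (cut-off profiles approximated by smooth even tests). The rows G1.05 ("floor of the
bottom eigenvalue ∀ a") and G1.14 need the OPPOSITE direction, GAL-1: a floor `ε₁^{(N)}(a) ≥ -σ` holding for ALL
truncations `N` must bound the CONTINUUM even ground energy, `ε_ev(a) ≥ -σ` — Galerkin completeness. Its analytic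
content is the mirror density (ii′) typed here:

* `TestToProfileFormDensity` (TYPED, statement only): every smooth even REAL test supported in `[-a, a]` is
  approximated by cut-off cosine profiles `cutoffProfile (a, N) v` simultaneously in `L²` norm and in the value of
  `Re Q` (informal route: the `2a`-periodic extension of `g` is smooth, its Fourier truncations `P_N g` converge in
  every `C^k`; the cut-off jump `|P_N g(±a)| → 0`; `Q` is continuous across `H^s`, `s < 1/2`, which contains the jumps).
* `GalerkinFloorAt a σ` (TYPED shape of the rows' hypothesis): `-σ·|v|² ≤ vᵀ(ζ-block at (a, N))v` for all `N, v`.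
* PROVED `re_weilQuadratic_ge_of_galerkinFloor` : (i) → (ii′) → floor `-σ` at `a` (all `N`) → `-σ·∫|g|² ≤ Re Q(g)`
  for every smooth even real test `g` on `[-a, a]`;
* PROVED `galerkinToContinuum_of_identity_of_density` : (i) → (ii′) → `GalerkinToContinuum zetaDatum` — the cell's
  TYPED dictionary (`PfPersistenceAdmissibleClass`) is DISCHARGED modulo (i) and (ii′);
* PROVED `neg_le_weilEvenGroundEnergy_of_galerkinFloor` : (i) → (ii′) → floor `-σ` at `a` → `-σ ≤ ε_ev(a)` (complex
  even tests via the tree's real/imaginary decoupling `re_weilQuadratic_eq_re_add_im`);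
* PROVED `riemannHypothesis_of_galerkinFloors` : (i) → (ii′) → Galerkin floors `-σ_k` at `a_k → ∞` with `σ_k → 0`
  → RH, by the tree's thermometer `PfPersistenceM2.riemannHypothesis_of_evenGroundEnergy_floor` — the exact
  reduction behind the rows G1.05 / G1.14 (RH-strength label unchanged; GAL-0 (i) and GAL-1 (ii′) are the open inputs).
-/

set_option linter.dupNamespace false  -- the mandated namespace repeats `RiemannHypothesis`

noncomputable section

open Set MeasureTheory Matrix Filter
open scoped Topology
open Literature.NumberTheory.LFunctions

namespace Summit.RiemannHypothesis.RiemannHypothesis.Theorems.PfPersistence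

/-- **GAL-1 piece (ii′), `C_c^∞` TESTS ARE FORM-APPROXIMATED BY CUT-OFF COSINE PROFILES** (TYPED, statement only):
for every genuine half-length `a`, every smooth even real-valued test `g` with `tsupport g ⊆ [-a, a]` and every
`δ > 0` there are a truncation `N` and coefficients `v` whose cut-off profile at the window `(a, N)` is within `δ` of
`g` in `L²` norm squared and in the value of `Re Q`. Mirror of `CutoffProfileFormDensity` (GAL-0 (ii)).
(A `Prop`, statement only.) -/
def TestToProfileFormDensity : Prop :=
  ∀ (a : ℝ) (ha : 0 < a) (g : ℝ → ℂ), IsWeilTest g → tsupport g ⊆ Icc (-a) a → (∀ t, g (-t) = g t) →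
    (∀ t, (g t).im = 0) → ∀ δ : ℝ, 0 < δ →
      ∃ (N : ℕ) (v : Fin (N + 1) → ℝ),
        |(∫ t, ‖cutoffProfile ⟨a, N, ha⟩ v t‖ ^ 2) - ∫ t, ‖g t‖ ^ 2| ≤ δ ∧
          |(weilQuadratic (cutoffProfile ⟨a, N, ha⟩ v)).re - (weilQuadratic g).re| ≤ δ

/-- **GALERKIN FLOOR `-σ` AT HALF-LENGTH `a`, ALL TRUNCATIONS** (TYPED shape of the G1.05 / G1.14 hypothesis
"`ε₁^{(N)}(a) ≥ -σ` for every `N`", homogeneous form). (A `Prop`, a hypothesis shape.) -/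
def GalerkinFloorAt (a : ℝ) (ha : 0 < a) (σ : ℝ) : Prop :=
  ∀ (N : ℕ) (v : Fin (N + 1) → ℝ), -σ * (v ⬝ᵥ v) ≤ v ⬝ᵥ (zetaDatum ⟨a, N, ha⟩ *ᵥ v)

/-- PROVED: a floor may be relaxed. [folklore] -/
theorem GalerkinFloorAt.mono {a : ℝ} {ha : 0 < a} {σ σ' : ℝ} (h : GalerkinFloorAt a ha σ) (hσ : σ ≤ σ') :
    GalerkinFloorAt a ha σ' := fun N v =>
  (mul_le_mul_of_nonneg_right (neg_le_neg hσ) (Finset.sum_nonneg fun i _ => mul_self_nonneg (v i))).trans (h N v)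

/-- PROVED: all-window positivity of `ζ`'s datum is the floor `σ = 0` at every half-length. [folklore] -/
theorem galerkinFloorAt_zero_of_allWindowsPositive (h : AllWindowsPositive zetaDatum) (a : ℝ) (ha : 0 < a) :
    GalerkinFloorAt a ha 0 := fun N v => by
  simpa using h ⟨a, N, ha⟩ v

/-- **PROVED — GALERKIN FLOORS TRANSFER TO REAL EVEN TESTS (modulo GAL-0 (i) and GAL-1 (ii′)):** if `ζ`'s even
blocks at half-length `a` obey the floor `-σ` (`σ ≥ 0`) for every truncation, then `-σ·∫|g|² ≤ Re Q(g)` for every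
smooth even real test `g` supported in `[-a, a]`. [folklore] -/
theorem re_weilQuadratic_ge_of_galerkinFloor (hI : GalerkinMatrixIdentity) (hD : TestToProfileFormDensity)
    {a σ : ℝ} {ha : 0 < a} (hσ : 0 ≤ σ) (hfl : GalerkinFloorAt a ha σ) {g : ℝ → ℂ} (hg : IsWeilTest g)
    (hs : tsupport g ⊆ Icc (-a) a) (hev : ∀ t, g (-t) = g t) (hre : ∀ t, (g t).im = 0) :
    -σ * ∫ t, ‖g t‖ ^ 2 ≤ (weilQuadratic g).re := by
  refine le_of_forall_pos_le_add fun ε hε => ?_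
  have hM : 0 < σ + 1 := by linarith
  obtain ⟨N, v, hn, hq⟩ := hD a ha g hg hs hev hre (ε / (σ + 1)) (div_pos hε hM)
  obtain ⟨hQ, hN⟩ := hI ⟨a, N, ha⟩ v
  have hf := hfl N v
  rw [hQ, hN] at hf
  have hn' := (abs_le.1 hn).2
  have hq' := (abs_le.1 hq).2
  have hδ : σ * (ε / (σ + 1)) + ε / (σ + 1) = ε := by
    field_simp
  have hstep : σ * ∫ t, ‖cutoffProfile ⟨a, N, ha⟩ v t‖ ^ 2 ≤ σ * ((∫ t, ‖g t‖ ^ 2) + ε / (σ + 1)) :=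
    mul_le_mul_of_nonneg_left (by linarith) hσ
  linarith [hf, hq', hstep, hδ]

/-- **PROVED — THE CELL'S TYPED DICTIONARY, DISCHARGED MODULO GAL-0 (i) AND GAL-1 (ii′):**
`GalerkinToContinuum zetaDatum` (`PfPersistenceAdmissibleClass`: all-window positivity of `ζ`'s datum ⇒ `Re Q ≥ 0`
on smooth even real tests) follows from the window-matrix identity and the test-to-profile form density. [folklore] -/
theorem galerkinToContinuum_of_identity_of_density (hI : GalerkinMatrixIdentity) (hD : TestToProfileFormDensity) :
    GalerkinToContinuum zetaDatum := by
  intro hpos g hg hev hre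
  -- every test lives in some genuine window `[-a, a]`, `a = max r 1 > 0` (cf. the tree's
  -- `Cruxes.ConeMagnification.Sketch.exists_window_of_isWeilTest`; inlined to keep this file's imports inside the cell)
  obtain ⟨r, hr⟩ := (hg.2.isCompact.isBounded).subset_closedBall (0 : ℝ)
  have hs : tsupport g ⊆ Icc (-max r 1) (max r 1) := by
    refine hr.trans ?_
    rw [Real.closedBall_eq_Icc, zero_sub, zero_add]
    exact Icc_subset_Icc (neg_le_neg (le_max_left _ _)) (le_max_left _ _)
  have h := re_weilQuadratic_ge_of_galerkinFloor hI hD le_rfl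
    (galerkinFloorAt_zero_of_allWindowsPositive hpos (max r 1) (lt_max_of_lt_right one_pos)) hg hs hev hre
  simpa using h

/-! ## Complex even tests: the floor on `ε_ev(a)` -/

/-- PROVED: the real part of a test, as a complex-valued function, is supported inside the test's support.
[folklore] -/
theorem tsupport_ofReal_re_subset (g : ℝ → ℂ) : tsupport (fun t => (((g t).re : ℝ) : ℂ)) ⊆ tsupport g :=
  closure_mono (Function.support_comp_subset (g := fun z : ℂ => ((z.re : ℝ) : ℂ)) (by simp) g)

/-- PROVED: same for the imaginary part. [folklore] -/
theorem tsupport_ofReal_im_subset (g : ℝ → ℂ) : tsupport (fun t => (((g t).im : ℝ) : ℂ)) ⊆ tsupport g :=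
  closure_mono (Function.support_comp_subset (g := fun z : ℂ => ((z.im : ℝ) : ℂ)) (by simp) g)

/-- PROVED: `∫|g|² = ∫|Re g|² + ∫|Im g|²` for a test `g`. [folklore] -/
theorem integral_norm_sq_eq_re_add_im {g : ℝ → ℂ} (hg : IsWeilTest g) :
    ∫ t, ‖g t‖ ^ 2 = (∫ t, ‖(((g t).re : ℝ) : ℂ)‖ ^ 2) + ∫ t, ‖(((g t).im : ℝ) : ℂ)‖ ^ 2 := by
  rw [← integral_add (isWeilTest_ofReal_re hg).integrable_norm_sq (isWeilTest_ofReal_im hg).integrable_norm_sq]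
  refine integral_congr_ae (Eventually.of_forall fun t => ?_)
  simp only [Complex.norm_real, Real.norm_eq_abs, sq_abs, Complex.sq_norm, Complex.normSq_apply]
  ring

/-- **PROVED — GALERKIN FLOORS TRANSFER TO THE CONTINUUM EVEN GROUND ENERGY (modulo GAL-0 (i), GAL-1 (ii′)):**
a floor `-σ` (`σ ≥ 0`) on `ζ`'s even blocks at half-length `a` for every truncation gives `-σ ≤ ε_ev(a)`
(`weilEvenGroundEnergy`, infimum over smooth COMPLEX even tests — reduced to real ones by the tree's decoupling
`re_weilQuadratic_eq_re_add_im`). [folklore] -/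
theorem neg_le_weilEvenGroundEnergy_of_galerkinFloor (hI : GalerkinMatrixIdentity) (hD : TestToProfileFormDensity)
    {a σ : ℝ} {ha : 0 < a} (hσ : 0 ≤ σ) (hfl : GalerkinFloorAt a ha σ) : -σ ≤ weilEvenGroundEnergy a := by
  refine le_weilEvenGroundEnergy_of_forall ha fun g hg hs hev hn => ?_
  rw [re_weilQuadratic_eq_re_add_im hg]
  have h₁ := re_weilQuadratic_ge_of_galerkinFloor hI hD hσ hfl (isWeilTest_ofReal_re hg)
    ((tsupport_ofReal_re_subset g).trans hs) (fun t => by simp [hev t]) (fun t => Complex.ofReal_im _)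
  have h₂ := re_weilQuadratic_ge_of_galerkinFloor hI hD hσ hfl (isWeilTest_ofReal_im hg)
    ((tsupport_ofReal_im_subset g).trans hs) (fun t => by simp [hev t]) (fun t => Complex.ofReal_im _)
  have hsum := integral_norm_sq_eq_re_add_im hg
  rw [hn] at hsum
  nlinarith [h₁, h₂, hsum]

/-- **PROVED — THE G1.05 / G1.14 THERMOMETER REDUCTION (RH-strength label; conditional, no RH claim):** modulo
GAL-0 (i) and GAL-1 (ii′), Galerkin floors `-σ_k` (all truncations) at half-lengths `a_k → ∞` with `σ_k → 0` imply
RH, by the tree's thermometer `PfPersistenceM2.riemannHypothesis_of_evenGroundEnergy_floor`. Negative `σ_k` are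
clipped to `0` (a positive floor is in particular the floor `0`). [folklore] -/
theorem riemannHypothesis_of_galerkinFloors (hI : GalerkinMatrixIdentity) (hD : TestToProfileFormDensity)
    {a σ : ℕ → ℝ} (ha : ∀ k, 0 < a k) (hat : Tendsto a atTop atTop) (hσ : Tendsto σ atTop (𝓝 0))
    (hfl : ∀ k, GalerkinFloorAt (a k) (ha k) (σ k)) : RiemannHypothesis := by
  refine PfPersistenceM2.riemannHypothesis_of_evenGroundEnergy_floor (σ := fun k => max (σ k) 0) hat ?_
    (Eventually.of_forall fun k => ?_)
  · simpa using hσ.max (tendsto_const_nhds (x := (0 : ℝ)))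
  · exact neg_le_weilEvenGroundEnergy_of_galerkinFloor hI hD (le_max_right _ _) ((hfl k).mono (le_max_left _ _))

end Summit.RiemannHypothesis.RiemannHypothesis.Theorems.PfPersistence

end
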